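import Summits.BirchSwinnertonDyer.Rank1Residual.X1.CongruenceTransfer
import Summits.BirchSwinnertonDyer.Rank1Residual.X1.RankOneParitySqueezeLeaf
import HarnessLib

/-!
# Route G at RANK ONE on class X1: the Greenberg–Vatsal congruence transfer of `λ` with the ODD-parity
# squeeze ⇒ Mazur's main conjecture at a rank-one leaf pair from a CLOSED congruent relative
# (sequel `X1/RankOneCongruenceTransferBSD.lean`: + the Schneider certificate ⇒ `BSD(E,p)`, no `#Ш_an`)

HONEST FRAMING (cell `b2b-bsdres`, run/shared/lean/b2b/bsd-rank1-residual/, verbatim in every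
file): the goal of the cell is to DELETE the COMBINATION-SHAPED residual classes of the
Birch–Swinnerton-Dyer formula for ALL analytic-rank `≤ 1` elliptic curves over `ℚ` — "full BSD
formula for every rank `≤ 1` curve in class `C`" assembled STRICTLY from published theorems — so
that the rank-`≤ 1` remainder becomes exactly the CONSTRUCTION-SHAPED classes, which are TYPED
(missing-input `Prop`s), NOT attempted. This is not "finishing BSD". Unit `b2b-bsdres-x1a` (X1 prover
A; CLASS-OWNERS row "X1 (r = 1)"), gen 11: research route; NO CLAIM BEYOND STATED CLASSES; nothing
here changes a label; no new named fact, no new def (theorems only, over PUBLISHED named facts and the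
cell's typed per-pair inputs `AnalyticMuLE`, `AnalyticLambdaEq`, `TorsionIso`, `CongruentLambdaShift`,
`MazurMainConjecture` at the PARTNER).

WHY THIS FILE. Sub-cell eisenstein-p1's route G (`X1/CongruenceTransfer.lean`, Greenberg–Vatsal, Invent.
Math. 142 (2000) §2: for good ordinary Eisenstein pairs with `E₀[p] ≅ E₀'[p]` and `μ = 0` on both sides,
`λ_alg(E₀) = λ_alg(E₀') + e` with an explicit local integer `e`; a CLOSED partner `E₀'` — Mazur's main
conjecture known there — makes `λ_alg(E₀) = λ_an(E₀') + e` KNOWN) closes Mazur's main conjecture on the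
RANK-ZERO leaf by the EVEN-parity squeeze (`λ(f_E)` even at Selmer corank `0`, Greenberg Prop. 3.10).
Its author handed the rank-one half to this seat (HOME/INBOX 2026-08-20T12:29Z: at `p = 3`,
`N < 5·10⁵`, 4 132 of the 8 208 rank-one X1 classes beyond the window and 68 window classes have a
closed congruent relative, the transferred `λ_alg(E₀)` equals the certified `λ_an(E₀)` in every case,
"your Schneider/`p`-adic-GZ step gives `BSD_p`"). This file is that half:

* §1 (any good ordinary Eisenstein pair of Selmer corank `1`): `lambdaPartAt_of_congruentLambdaShift_of_odd`
  — `λ(f_E)` is ODD (Prop. 3.10 at corank `1`), `λ(f_E) = n' + e` (transfer), `λ(f_E·h) = λ_an = n` odd,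
  so `λ(h) = n − λ(f_E)` is even and `≤ 1` as soon as `n ≤ n' + e + 1`, hence `0`: the λ-part;
  `mazurMainConjecture_of_congruentLambdaShift_of_odd`; and the parity-free form
  `mazurMainConjecture_of_congruentLambdaShift` (`n ≤ n' + e`, any rank), not spelled out in
  `X1/CongruenceTransfer.lean`; `analyticLambda_eq_transfer_of_mazurMainConjecture` (under Mazur's main
  conjecture at `E₀` the transferred value IS `λ_an(E₀)` — the census's "0 mismatches" as a prediction).
* §2 (the rank-one leaf `RankOne.Leaf`, BOTH Greenberg–Vatsal types): corank `1` by Gross–Zagier–Kolyvagin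
  (`RankOne.Leaf.selmerCorank_eq_one`), `λ_an` odd automatically (x1b's `RankOne.Leaf.odd_of_analyticLambdaEq`,
  from the Mazur–Tate–Teitelbaum functional equation), so **`RankOne.Leaf.mazurMainConjecture_of_congruent`**
  needs only the closed partner, `E₀[p] ≅ E₀'[p]`, the transfer datum, two `μ_an = 0`, `λ_an(E₀) = n`,
  `n ≤ n' + e + 1`; consistency `RankOne.Leaf.le_of_congruentLambdaShift` (`n' + e ≤ n`, Kato's direction).
* Sequel `X1/RankOneCongruenceTransferBSD.lean`: Mazur's main conjecture from §2 + Schneider's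
  non-degeneracy at the pair (x1a `RankOne.Leaf.bsdp_of_mazurMainConjecture_of_schneider`) ⇒ `BSD(E,p)` in
  the three certificate currencies, with NO `#Ш(E/ℚ)_an` input (route B's per-pair form needs `p ∤ #Ш_an` to
  turn Kato–Wuthrich divisibility into the main conjecture; here the main conjecture is TRANSFERRED), and the
  type-B forms (Greenberg–Vatsal Thm. (1.3) + certificate, no partner, no `#Ш_an`).

What this is NOT: a class theorem (partner, transfer datum and certificate are per pair; the transfer
datum `CongruentLambdaShift` is Greenberg–Vatsal §2 read OUTSIDE the kernel, as in eisenstein-p1's file);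
a change of the class-level residue (X1-CHAIN §17b: A1 = Mazur's MC at anomalous type-A pairs — unstated
in print, Keller–Yin PRE — plus Schneider; B1 = Schneider).

References: [GreenbergVatsal2000] Thm. (1.3), §2 Props. (2.4), (2.8), Cor. (2.3), p. 27;
[GreenbergLNM1716] Prop. 3.10; [Wuthrich2014] Thm. 16; [BalakrishnanMullerStein2015] Thm. 1.7;
[MazurTateTeitelbaum1986Invent] §I.17–I.18;
HOME/b2b-bsdres-eisenstein-p1/X1R0-GAPMAP.md §16; HOME/b2b-bsdres-x1a/X1-CHAIN.md §17b, §19, §20.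
-/

noncomputable section

open scoped Classical MatrixGroups ModularForm

open PowerSeries CongruenceSubgroup WeierstrassCurve Literature.NumberTheory.EllipticCurves
  Literature.NumberTheory.EllipticCurves.ModularForms
  Literature.NumberTheory.EllipticCurves.Wuthrich2014
  Literature.NumberTheory.EllipticCurves.Rank1Residual
  Literature.NumberTheory.EllipticCurves.Greenberg1999
  Summit.BirchSwinnertonDyer.BirchSwinnertonDyer.Theorems
  Summit.BirchSwinnertonDyer.BirchSwinnertonDyer.Theorems.Rank1ResidualX1Defs
  Summit.BirchSwinnertonDyer.Rank1Residual.X1.MuLambda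
  Summit.BirchSwinnertonDyer.Rank1Residual.X1.MuPart
  Summit.BirchSwinnertonDyer.Rank1Residual.X1.ParitySqueeze
  Summit.BirchSwinnertonDyer.Rank1Residual.X1.CongruenceTransfer

set_option autoImplicit false

namespace Summit.BirchSwinnertonDyer.Rank1Residual.X1.RankOneCongruenceTransfer

/-! ## §1. The transfer with the ODD-parity squeeze (Selmer corank `1`); the parity-free form -/

section Transfer

variable {W W' : WeierstrassCurve ℚ} [W.IsElliptic] [W.IsGloballyMinimal]
  [W'.IsElliptic] [W'.IsGloballyMinimal] {p : ℕ} [Fact p.Prime]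

/-- **Route G, λ-part with ODD parity (Selmer corank `1`).** Good ordinary Eisenstein pairs `(E₀, p)`,
`(E₀', p)`, `p ≠ 2`, with `corank_{ℤ_p} Sel_{p^∞}(E₀/ℚ) = 1` (`hcork`); granted the PUBLISHED facts
Wuthrich 2014 Thm. 16 (`hW16`), Greenberg's Prop. 3.10 (`h310`) and modularity (`hmod`): if
`μ_an(E₀) = μ_an(E₀') = 0`, Mazur's main conjecture holds at `E₀'` with `λ_an(E₀') = n'`,
`E₀[p] ≅ E₀'[p]`, `CongruentLambdaShift W W' p e` (the transfer `λ(E₀) = λ(E₀') + e`, Greenberg–Vatsal §2),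
`λ_an(E₀) = n` is ODD and `n ≤ n' + e + 1`, then the λ-part `LambdaPartAt W p` holds:
`λ(f_E) = n' + e` (`lambdaInvariant_eq_of_congruentLambdaShift`) is odd (Prop. 3.10), so
`λ(h) = n − λ(f_E)` is even and `≤ 1`, i.e. `0`. The rank-one twin of eisenstein-p1's
`lambdaPartAt_of_congruentLambdaShift_of_even`. [cite: GreenbergLNM1716, Prop. 3.10]
[cite: GreenbergVatsal2000, §2 Prop. (2.8), Cor. (2.3), Prop. (2.4), p. 27]
[cite: Wuthrich2014, Thm. 16 (p. 397)] -/
theorem lambdaPartAt_of_congruentLambdaShift_of_odd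
    (hW16 : Wuthrich2014.charIdeal_dvd_padicLFunction)
    (h310 : prop310_selmerCorank_mod_two_eq_lambdaInvariant)
    (hmod : nonempty_modularParametrizationData)
    (hp : p ≠ 2) (hgood : W.HasGoodReductionAtPrime p) (hord : ¬ (p : ℤ) ∣ W.frobeniusTrace p)
    (hred : ¬ W.HasIrreducibleModPGaloisRep p) (hcork : W.selmerCorank p = 1)
    (hgood' : W'.HasGoodReductionAtPrime p) (hord' : ¬ (p : ℤ) ∣ W'.frobeniusTrace p)
    (hred' : ¬ W'.HasIrreducibleModPGaloisRep p)
    (hμ : AnalyticMuLE W p 0) (hμ' : AnalyticMuLE W' p 0)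
    (hMC' : MazurMainConjecture W' p) {n' : ℕ} (hlam' : AnalyticLambdaEq W' p n')
    (hiso : TorsionIso W W' p) {e : ℤ} (hG : CongruentLambdaShift W W' p e)
    {n : ℕ} (hn : Odd n) (hlam : AnalyticLambdaEq W p n) (hne : (n : ℤ) ≤ n' + e + 1) :
    LambdaPartAt W p := by
  intro κ γ hκ hγ hγ' _ f hf ϖ hϖ D g h hchar hι
  haveI : Module.Finite (IwasawaAlgebra p) D.X := D.module_finite_holds hγ
  obtain ⟨hX, -⟩ := hW16 W p hp ⟨hgood, hord⟩ hred hκ hγ hγ' hf D ϖ hϖ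
  have hgh : g * h ≠ 0 := mul_ne_zero_of_iota_eq hgood hord hf hϖ D hι
  have hg : g ≠ 0 := fun h0 ↦ hgh (by rw [h0, zero_mul])
  have hh : h ≠ 0 := fun h0 ↦ hgh (by rw [h0, mul_zero])
  have h1 : lam (g * h) = n := hlam f hf ϖ hϖ (g * h) hι
  have h2 : lam g = lambdaInvariant p D.X := lam_generator_eq_lambdaInvariant D.X hX hg hchar
  obtain ⟨-, h3⟩ := lambdaInvariant_eq_of_congruentLambdaShift hW16 hmod hp hgood hord hred hgood'
    hord' hred' hμ hμ' hMC' hlam' hiso hG hκ hγ hγ' D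
  have hodd : Odd (lam g) := by
    rw [h2]
    exact prop310_selmerCorank_mod_two_eq_lambdaInvariant.odd_lambdaInvariant_of_selmerCorank_eq_one
      h310 W p hp hκ hγ D hX hcork
  have hgh2 : Odd (lam (g * h)) := by rw [h1]; exact hn
  rw [lam_mul hg hh] at h1 hgh2 ⊢
  obtain ⟨a, ha⟩ := hodd
  obtain ⟨b, hb⟩ := hgh2
  omega

/-- **Route G with ODD parity: Mazur's main conjecture** at a good ordinary Eisenstein pair `(E₀, p)`,
`p ≠ 2`, of Selmer corank `1`, from `μ_an(E₀) = 0` (μ-part by `MuPart.muPartAt_of_analyticMuLE_zero`),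
`λ_an(E₀) = n` odd, a closed congruent partner and `n ≤ n' + e + 1` (`MuLambda.mazurMainConjecture_iff_muPart_and_lambdaPart`).
[cite: GreenbergLNM1716, Prop. 3.10] [cite: GreenbergVatsal2000, §2 p. 27]
[cite: Wuthrich2014, Thm. 16 (p. 397)] -/
theorem mazurMainConjecture_of_congruentLambdaShift_of_odd
    (hW16 : Wuthrich2014.charIdeal_dvd_padicLFunction)
    (h310 : prop310_selmerCorank_mod_two_eq_lambdaInvariant)
    (hmod : nonempty_modularParametrizationData)
    (hp : p ≠ 2) (hgood : W.HasGoodReductionAtPrime p) (hord : ¬ (p : ℤ) ∣ W.frobeniusTrace p)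
    (hred : ¬ W.HasIrreducibleModPGaloisRep p) (hcork : W.selmerCorank p = 1)
    (hgood' : W'.HasGoodReductionAtPrime p) (hord' : ¬ (p : ℤ) ∣ W'.frobeniusTrace p)
    (hred' : ¬ W'.HasIrreducibleModPGaloisRep p)
    (hμ : AnalyticMuLE W p 0) (hμ' : AnalyticMuLE W' p 0)
    (hMC' : MazurMainConjecture W' p) {n' : ℕ} (hlam' : AnalyticLambdaEq W' p n')
    (hiso : TorsionIso W W' p) {e : ℤ} (hG : CongruentLambdaShift W W' p e)
    {n : ℕ} (hn : Odd n) (hlam : AnalyticLambdaEq W p n) (hne : (n : ℤ) ≤ n' + e + 1) :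
    MazurMainConjecture W p :=
  (mazurMainConjecture_iff_muPart_and_lambdaPart hW16 hp hgood hord hred).mpr
    ⟨muPartAt_of_analyticMuLE_zero hW16 hp hgood hord hred hμ,
      lambdaPartAt_of_congruentLambdaShift_of_odd hW16 h310 hmod hp hgood hord hred hcork hgood' hord'
        hred' hμ hμ' hMC' hlam' hiso hG hn hlam hne⟩

/-- **Route G, parity-free (any rank): Mazur's main conjecture** at a good ordinary Eisenstein pair
`(E₀, p)`, `p ≠ 2`, from `μ_an(E₀) = 0`, `λ_an(E₀) = n`, a closed congruent partner and the SHARP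
inequality `n ≤ n' + e` (then `λ(f_E·h) = n ≤ n' + e = λ(f_E)`; eisenstein-p1's
`lambdaPartAt_of_congruentLambdaShift` + the μ-part). No Prop. 3.10, no corank hypothesis.
[cite: GreenbergVatsal2000, §2 p. 27] [cite: Wuthrich2014, Thm. 16 (p. 397)] -/
theorem mazurMainConjecture_of_congruentLambdaShift
    (hW16 : Wuthrich2014.charIdeal_dvd_padicLFunction) (hmod : nonempty_modularParametrizationData)
    (hp : p ≠ 2) (hgood : W.HasGoodReductionAtPrime p) (hord : ¬ (p : ℤ) ∣ W.frobeniusTrace p)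
    (hred : ¬ W.HasIrreducibleModPGaloisRep p)
    (hgood' : W'.HasGoodReductionAtPrime p) (hord' : ¬ (p : ℤ) ∣ W'.frobeniusTrace p)
    (hred' : ¬ W'.HasIrreducibleModPGaloisRep p)
    (hμ : AnalyticMuLE W p 0) (hμ' : AnalyticMuLE W' p 0)
    (hMC' : MazurMainConjecture W' p) {n' : ℕ} (hlam' : AnalyticLambdaEq W' p n')
    (hiso : TorsionIso W W' p) {e : ℤ} (hG : CongruentLambdaShift W W' p e)
    {n : ℕ} (hlam : AnalyticLambdaEq W p n) (hne : (n : ℤ) ≤ n' + e) :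
    MazurMainConjecture W p :=
  (mazurMainConjecture_iff_muPart_and_lambdaPart hW16 hp hgood hord hred).mpr
    ⟨muPartAt_of_analyticMuLE_zero hW16 hp hgood hord hred hμ,
      lambdaPartAt_of_congruentLambdaShift hW16 hmod hp hgood hord hred hgood' hord' hred' hμ hμ' hMC'
        hlam' hiso hG hlam hne⟩

/-- **Under Mazur's main conjecture at `E₀` the transferred value IS `λ_an(E₀)`: `n = n' + e`.** Good
ordinary Eisenstein pair `(E₀, p)`, `p ≠ 2`, a closed congruent partner with the transfer datum, and
`λ_an(E₀) = n`: the data exist (modularity `hmod`, the cyclotomic `κ, γ`, a dual datum, Wuthrich's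
factorisation `ϖ·L_p = ι(f_E·h)`), `n = λ(f_E) + λ(h) ≥ λ(f_E) = n' + e` always, and Mazur's main
conjecture at `E₀` gives the λ-part `λ(f_E·h) ≤ λ(f_E)`. This is the identity eisenstein-p1's census
checks on every closed–closed congruent pair (X1R0-GAPMAP §16.2: 794/794 at `N < 2·10⁴`; 4 132/4 132
rank-one classes at `p = 3`, `N < 5·10⁵`, against x1a's engine-C `λ_an`).
[cite: GreenbergVatsal2000, §2 p. 27] [cite: Wuthrich2014, Thm. 16 (p. 397)] -/
theorem analyticLambda_eq_transfer_of_mazurMainConjecture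
    (hW16 : Wuthrich2014.charIdeal_dvd_padicLFunction) (hmod : nonempty_modularParametrizationData)
    (hp : p ≠ 2) (hgood : W.HasGoodReductionAtPrime p) (hord : ¬ (p : ℤ) ∣ W.frobeniusTrace p)
    (hred : ¬ W.HasIrreducibleModPGaloisRep p)
    (hgood' : W'.HasGoodReductionAtPrime p) (hord' : ¬ (p : ℤ) ∣ W'.frobeniusTrace p)
    (hred' : ¬ W'.HasIrreducibleModPGaloisRep p)
    (hμ : AnalyticMuLE W p 0) (hμ' : AnalyticMuLE W' p 0)
    (hMC' : MazurMainConjecture W' p) {n' : ℕ} (hlam' : AnalyticLambdaEq W' p n')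
    (hiso : TorsionIso W W' p) {e : ℤ} (hG : CongruentLambdaShift W W' p e)
    {n : ℕ} (hlam : AnalyticLambdaEq W p n) (hMC : MazurMainConjecture W p) : (n : ℤ) = n' + e := by
  haveI : NeZero (W.conductorNorm ℤ) := ⟨(W.conductorNorm_pos_holds).ne'⟩
  obtain ⟨κ, hκ, γ, hγ, hγ'⟩ := exists_isCyclotomic_isTopGenerator_isCyclotomicVariable_holds p
  obtain ⟨D⟩ := W.nonempty_selmerDualData_holds κ γ hγ
  haveI : Module.Finite (IwasawaAlgebra p) D.X := D.module_finite_holds hγ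
  obtain ⟨hXt, f, ϖ, g, h, hf, hϖ, hchar, hι⟩ := isTorsion_and_exists_factorisation hW16 hmod hp hgood
    hord hred hκ hγ hγ' D
  have hgh : g * h ≠ 0 := mul_ne_zero_of_iota_eq hgood hord hf hϖ D hι
  have hg0 : g ≠ 0 := fun h0 ↦ hgh (by rw [h0, zero_mul])
  have hh0 : h ≠ 0 := fun h0 ↦ hgh (by rw [h0, mul_zero])
  have h1 : lam (g * h) = n := hlam f hf ϖ hϖ (g * h) hι
  have h2 : lam g = lambdaInvariant p D.X := lam_generator_eq_lambdaInvariant D.X hXt hg0 hchar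
  obtain ⟨-, h3⟩ := lambdaInvariant_eq_of_congruentLambdaShift hW16 hmod hp hgood hord hred hgood'
    hord' hred' hμ hμ' hMC' hlam' hiso hG hκ hγ hγ' D
  have h4 : lam g ≤ lam (g * h) := lam_le_lam_mul hg0 hh0
  have h5 : lam (g * h) ≤ lam g :=
    ((mazurMainConjecture_iff_muPart_and_lambdaPart hW16 hp hgood hord hred).mp hMC).2 κ γ hκ hγ hγ' f
      hf ϖ hϖ D g h hchar hι
  omega

end Transfer

/-! ## §2. On the rank-one leaf X1 ∩ {r = 1}: Mazur's main conjecture from a closed congruent relative -/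

section Leaf

variable {W W' : WeierstrassCurve ℚ} [W.IsElliptic] [W.IsGloballyMinimal]
  [W'.IsElliptic] [W'.IsGloballyMinimal] {p : ℕ} [Fact p.Prime]

omit [W'.IsElliptic] [W'.IsGloballyMinimal] in
/-- **Selmer corank `1` on the rank-one leaf**: Gross–Zagier–Kolyvagin (`hGZK`: `rank E(ℚ) = 1` and `Ш`
finite at analytic rank `1`) and the corank identity `s_p = r + t_p` (tree
`selmerCorank_eq_mordellWeilRank_of_finite_shaPrimary`). [cite: Greenberg1999, §1] -/
theorem _root_.Summit.BirchSwinnertonDyer.Rank1Residual.X1.RankOne.Leaf.selmerCorank_eq_one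
    (hGZK : rank_eq_analyticRank_of_analyticRank_le_one) (hL : RankOne.Leaf W p) :
    W.selmerCorank p = 1 := by
  obtain ⟨hrk, hfin⟩ := hGZK W hL.analyticRank_eq_one.le
  haveI : Finite W.sha := hfin
  have hfinp : Finite (AddCommGroup.primaryComponent W.sha p) := inferInstance
  rw [selmerCorank_eq_mordellWeilRank_of_finite_shaPrimary W p hfinp, hrk, hL.analyticRank_eq_one]

/-- **Route G on the rank-one leaf: Mazur's main conjecture at `E₀`** (either Greenberg–Vatsal type) from
`μ_an(E₀) = 0`, `λ_an(E₀) = n`, a CLOSED congruent partner `E₀'` (good ordinary Eisenstein at `p`,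
`μ_an = 0`, `λ_an = n'`, Mazur's main conjecture — per pair: routes S/P/T/C/G at a rank-`0` leaf pair,
x1b's P₁/P₃ at a rank-one leaf pair, or Greenberg–Vatsal at a type-B pair), `E₀[p] ≅ E₀'[p]`, the
transfer datum `λ(E₀) = λ(E₀') + e`, and `n ≤ n' + e + 1`. Parity is automatic on the leaf: `λ_an` is odd
(`RankOne.Leaf.odd_of_analyticLambdaEq`, Mazur–Tate–Teitelbaum functional equation) and `λ(f_E)` is odd
(Prop. 3.10 at corank `1`, `RankOne.Leaf.selmerCorank_eq_one`). Facts `hW16`, `h310`, `hmod`, `hGZK` all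
PUBLISHED. [cite: GreenbergLNM1716, Prop. 3.10] [cite: GreenbergVatsal2000, §2 p. 27]
[cite: Wuthrich2014, Thm. 16 (p. 397)] [cite: MazurTateTeitelbaum1986Invent, §I.17–I.18] -/
theorem _root_.Summit.BirchSwinnertonDyer.Rank1Residual.X1.RankOne.Leaf.mazurMainConjecture_of_congruent
    (hW16 : Wuthrich2014.charIdeal_dvd_padicLFunction)
    (h310 : prop310_selmerCorank_mod_two_eq_lambdaInvariant)
    (hmod : nonempty_modularParametrizationData)
    (hGZK : rank_eq_analyticRank_of_analyticRank_le_one) (hL : RankOne.Leaf W p)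
    (hgood' : W'.HasGoodReductionAtPrime p) (hord' : ¬ (p : ℤ) ∣ W'.frobeniusTrace p)
    (hred' : ¬ W'.HasIrreducibleModPGaloisRep p)
    (hμ : AnalyticMuLE W p 0) (hμ' : AnalyticMuLE W' p 0)
    (hMC' : MazurMainConjecture W' p) {n' : ℕ} (hlam' : AnalyticLambdaEq W' p n')
    (hiso : TorsionIso W W' p) {e : ℤ} (hG : CongruentLambdaShift W W' p e)
    {n : ℕ} (hlam : AnalyticLambdaEq W p n) (hne : (n : ℤ) ≤ n' + e + 1) :
    MazurMainConjecture W p :=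
  have hX := isClassX1_of_classX1 hL.1
  mazurMainConjecture_of_congruentLambdaShift_of_odd hW16 h310 hmod hX.two_ne
    hX.hasGoodReductionAtPrime hX.not_dvd_frobeniusTrace hX.not_hasIrreducibleModPGaloisRep
    (hL.selmerCorank_eq_one hGZK) hgood' hord' hred' hμ hμ' hMC' hlam' hiso hG
    (hL.odd_of_analyticLambdaEq hW16 hmod hlam) hlam hne

omit [W'.IsElliptic] in
/-- The partner hypotheses of route G read off X1-membership of the PARTNER (the census case: the
closed relative is itself an X1 pair of either rank — good reduction, anomalous hence ordinary, `E[p]`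
reducible; tree `Rank1Residual.isClassX1_of_classX1`). [folklore] -/
theorem partner_of_classX1 (hX1' : ClassX1 W' p) :
    W'.HasGoodReductionAtPrime p ∧ ¬ (p : ℤ) ∣ W'.frobeniusTrace p ∧
      ¬ W'.HasIrreducibleModPGaloisRep p :=
  have hX' := isClassX1_of_classX1 hX1'
  ⟨hX'.hasGoodReductionAtPrime, hX'.not_dvd_frobeniusTrace, hX'.not_hasIrreducibleModPGaloisRep⟩

/-- **Route G on the rank-one leaf with an X1 partner** (rank-`0` leaf pair closed by S/P/T/C/G, or
rank-one leaf pair closed by P₁/P₃): the reduction hypotheses on `W'` are read off `ClassX1 W' p`.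
[cite: GreenbergVatsal2000, §2 p. 27] [cite: Wuthrich2014, Thm. 16 (p. 397)] -/
theorem _root_.Summit.BirchSwinnertonDyer.Rank1Residual.X1.RankOne.Leaf.mazurMainConjecture_of_congruent_classX1
    (hW16 : Wuthrich2014.charIdeal_dvd_padicLFunction)
    (h310 : prop310_selmerCorank_mod_two_eq_lambdaInvariant)
    (hmod : nonempty_modularParametrizationData)
    (hGZK : rank_eq_analyticRank_of_analyticRank_le_one) (hL : RankOne.Leaf W p)
    (hX1' : ClassX1 W' p) (hμ : AnalyticMuLE W p 0) (hμ' : AnalyticMuLE W' p 0)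
    (hMC' : MazurMainConjecture W' p) {n' : ℕ} (hlam' : AnalyticLambdaEq W' p n')
    (hiso : TorsionIso W W' p) {e : ℤ} (hG : CongruentLambdaShift W W' p e)
    {n : ℕ} (hlam : AnalyticLambdaEq W p n) (hne : (n : ℤ) ≤ n' + e + 1) :
    MazurMainConjecture W p :=
  have hP := partner_of_classX1 hX1'
  hL.mazurMainConjecture_of_congruent hW16 h310 hmod hGZK hP.1 hP.2.1 hP.2.2 hμ hμ' hMC' hlam' hiso hG
    hlam hne

/-- **Consistency on the rank-one leaf (Kato–Wuthrich direction): the transferred value never exceeds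
`λ_an(E₀)`**, `n' + e ≤ n` — the rank-one copy of eisenstein-p1's `Leaf.le_of_congruentLambdaShift` (the
argument uses only X1-membership: `n = λ(f_E) + λ(h) ≥ λ(f_E) = λ(X) = n' + e`). With Mazur's main
conjecture at `E₀` it is an equality (`analyticLambda_eq_transfer_of_mazurMainConjecture`).
[cite: GreenbergVatsal2000, §2 p. 27] [cite: Wuthrich2014, Thm. 16 (p. 397)] -/
theorem _root_.Summit.BirchSwinnertonDyer.Rank1Residual.X1.RankOne.Leaf.le_of_congruentLambdaShift
    (hW16 : Wuthrich2014.charIdeal_dvd_padicLFunction) (hmod : nonempty_modularParametrizationData)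
    (hL : RankOne.Leaf W p)
    (hgood' : W'.HasGoodReductionAtPrime p) (hord' : ¬ (p : ℤ) ∣ W'.frobeniusTrace p)
    (hred' : ¬ W'.HasIrreducibleModPGaloisRep p)
    (hμ : AnalyticMuLE W p 0) (hμ' : AnalyticMuLE W' p 0)
    (hMC' : MazurMainConjecture W' p) {n' : ℕ} (hlam' : AnalyticLambdaEq W' p n')
    (hiso : TorsionIso W W' p) {e : ℤ} (hG : CongruentLambdaShift W W' p e)
    {n : ℕ} (hlam : AnalyticLambdaEq W p n) : (n' : ℤ) + e ≤ n := by
  have hX := isClassX1_of_classX1 hL.1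
  haveI : NeZero (W.conductorNorm ℤ) := ⟨(W.conductorNorm_pos_holds).ne'⟩
  obtain ⟨κ, hκ, γ, hγ, hγ'⟩ := exists_isCyclotomic_isTopGenerator_isCyclotomicVariable_holds p
  obtain ⟨D⟩ := W.nonempty_selmerDualData_holds κ γ hγ
  haveI : Module.Finite (IwasawaAlgebra p) D.X := D.module_finite_holds hγ
  obtain ⟨hXt, f, ϖ, g, h, hf, hϖ, hchar, hι⟩ := isTorsion_and_exists_factorisation hW16 hmod
    hX.two_ne hX.hasGoodReductionAtPrime hX.not_dvd_frobeniusTrace hX.not_hasIrreducibleModPGaloisRep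
    hκ hγ hγ' D
  have hgh : g * h ≠ 0 :=
    mul_ne_zero_of_iota_eq hX.hasGoodReductionAtPrime hX.not_dvd_frobeniusTrace hf hϖ D hι
  have hg0 : g ≠ 0 := fun h0 ↦ hgh (by rw [h0, zero_mul])
  have hh0 : h ≠ 0 := fun h0 ↦ hgh (by rw [h0, mul_zero])
  have h1 : lam (g * h) = n := hlam f hf ϖ hϖ (g * h) hι
  have h2 : lam g = lambdaInvariant p D.X := lam_generator_eq_lambdaInvariant D.X hXt hg0 hchar
  obtain ⟨-, h3⟩ := lambdaInvariant_eq_of_congruentLambdaShift hW16 hmod hX.two_ne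
    hX.hasGoodReductionAtPrime hX.not_dvd_frobeniusTrace hX.not_hasIrreducibleModPGaloisRep hgood'
    hord' hred' hμ hμ' hMC' hlam' hiso hG hκ hγ hγ' D
  have h4 : lam g ≤ lam (g * h) := lam_le_lam_mul hg0 hh0
  omega

/-- **On the rank-one leaf, with Mazur's main conjecture at `E₀` (e.g. after the squeeze): `n = n' + e`.**
[cite: GreenbergVatsal2000, §2 p. 27] [cite: Wuthrich2014, Thm. 16 (p. 397)] -/
theorem _root_.Summit.BirchSwinnertonDyer.Rank1Residual.X1.RankOne.Leaf.analyticLambda_eq_transfer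
    (hW16 : Wuthrich2014.charIdeal_dvd_padicLFunction) (hmod : nonempty_modularParametrizationData)
    (hL : RankOne.Leaf W p)
    (hgood' : W'.HasGoodReductionAtPrime p) (hord' : ¬ (p : ℤ) ∣ W'.frobeniusTrace p)
    (hred' : ¬ W'.HasIrreducibleModPGaloisRep p)
    (hμ : AnalyticMuLE W p 0) (hμ' : AnalyticMuLE W' p 0)
    (hMC' : MazurMainConjecture W' p) {n' : ℕ} (hlam' : AnalyticLambdaEq W' p n')
    (hiso : TorsionIso W W' p) {e : ℤ} (hG : CongruentLambdaShift W W' p e)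
    {n : ℕ} (hlam : AnalyticLambdaEq W p n) (hMC : MazurMainConjecture W p) : (n : ℤ) = n' + e :=
  have hX := isClassX1_of_classX1 hL.1
  analyticLambda_eq_transfer_of_mazurMainConjecture hW16 hmod hX.two_ne hX.hasGoodReductionAtPrime
    hX.not_dvd_frobeniusTrace hX.not_hasIrreducibleModPGaloisRep hgood' hord' hred' hμ hμ' hMC' hlam'
    hiso hG hlam hMC

end Leaf

end Summit.BirchSwinnertonDyer.Rank1Residual.X1.RankOneCongruenceTransfer

end
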